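import Summits.BirchSwinnertonDyer.BirchSwinnertonDyer.Theorems.SchneiderFreeAdditiveX3PoitouTateReciprocityGeneralBase
import Literature.NumberTheory.GaloisRepresentations.PresentationCocycleTransportPlaces
import HarnessLib

/-!
# `poitouTate_selmerStructure_duality K` HOLDS for every number field `K` (Milne *ADT* I Cor. 2.3 ∧ Thm. 4.10 (b) ∧ Thm. 2.6 ∧
# Howard 2004 Thm. 2.1.11): the E-side idèle package of the presentation road, assembled

Cell `bsd-schneider`, seat `door-c4` g18.  Crux `stmt-BirchSwinnertonDyer-19295` `AnticycControlAdditiveK` (control corner; its binder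
`ControlFacts` (i) 19538 = this fact).  Theorems only; no definition, no named fact, no instance, no `sorry`.

THE ASSEMBLY.  `SchneiderFreeAdditiveX3PoitouTateReciprocityGeneralBase.poitouTate_selmerStructure_duality_of_idelePackage` (door-c4 g18)
proves the fact from ONE E-side idèle package per `(f, ŷ, T₀)`; every item of the package is now a tree theorem:
* layer `E ⊇ K(M)` and `c` with `ŷ = Inf_E c` — `FreePresentation.exists_layer_ge_inflG_eq` (door-c4 g17); a `1`-cocycle `γ` with
  `[γ] = c` (`H1_induction_on`);
* (P1) `classBarInv K (ŷ ∘ ∂(f ≫ g)) = inv E [b]` and (P2) the finite support, with a cocycle `b` representing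
  `β = iso^J_E ((f^{U_E})_* δ[γ])` — `FreePresentation.exists_cocycle_classBarInv_eq_inv` (door-c4 g18 p621227);
* `x := FreePresentation.inflatedClass ρ₀ _ γ = [σ ↦ γ(σ̄)]`;
* (P0) `x` unramified off a finite set — `exists_finset_forall_localization_inflatedClass_mem`;
* (P3) the finite dictionary — `localInv_H2π_eq_brauerInvariantEquiv` (transport by explicit cocycles + door-c5's `localInv_eq_readout`);
* (P4) the archimedean transport at every infinite place — `twoCocycleClass_archReadoutPair_pull_eq`
(the last three: `PresentationCocycleTransport(Places)`, door-c4 g18).  Hence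
**`poitouTate_selmerStructure_duality_holds (K) : poitouTate_selmerStructure_duality K`** for EVERY number field `K` (real places
included), the `hPT` input of every consumer in the tree (this route's `ControlFacts` (i), `stub_baseCountTors_of_poitouTate`,
`stub_ptSurj_of_poitouTate`; bsd-wall K4 `stub_poitouTateSelmerRat`; EisensteinPrimes / UniversalToricDescent / ErratumRoadFive …).

HONEST FRAMING: this is Milne *ADT* I Thm. 4.10 (b) (with Cor. 2.3, Thm. 2.6, Howard Thm. 2.1.11) for finite Galois modules over
number fields — classical (Poitou–Tate 1960s), here kernel-checked on the cell's Route A (door-c4/door-c5/door-c6, 2026-08-26…28).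
It is NOT a case of BSD; crux 19295 still needs `poitouTate_sha_tateDual` (PT2, Milne I 4.10 (a)) and Kolyvagin for its coinvariant stub.

## References
* J. S. Milne, *Arithmetic Duality Theorems* (2nd ed. 2006), I Cor. 2.3, Thm. 2.6, Thm. 4.10 and its proof, Lemma 4.13, Ex. 1.6 (c).
  [MilneADT2006]
* B. Howard, Compositio Math. 140 (2004), Thm. 2.1.11. [Howard2004HeegnerKolyvagin]
* J. W. S. Cassels, A. Fröhlich (eds.), *Algebraic Number Theory* (1967), Ch. VII (J. Tate). [CasselsFrohlichANT1967]
-/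

noncomputable section

open Function NumberField IsDedekindDomain CategoryTheory CategoryTheory.Abelian groupCohomology
open scoped NumberField ContRepresentation

set_option linter.dupNamespace false
set_option autoImplicit false

namespace Summit.BirchSwinnertonDyer.BirchSwinnertonDyer.Theorems.SchneiderFreeAdditiveX3.PoitouTateReduction

open Field
open Literature.NumberTheory.GaloisRepresentations Literature.NumberTheory.GaloisCohomology
open Literature.NumberTheory.GaloisRepresentations.DiscreteGaloisModule (mu TateDual tateDual localTatePairingZMod
  localTatePairingZMod_apply unramifiedSubgroup)
open Literature.Algebra.Homology Literature.Algebra.Homology.DiscreteRep Literature.Algebra.Homology.ExtPresentation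
open Literature.NumberTheory.GaloisRepresentations.IdeleClassBar (classBarD classBarInv GalLayer)
open Literature.NumberTheory.GaloisRepresentations.FreePresentation
open Literature.NumberTheory.GaloisRepresentations.HomDual (IdeleProjection readout readoutInvariant localReadout
  readout_eq_localReadout charZero_of_algebra equivariantMap restrictIntertwining isSES_restrict)
open Literature.NumberTheory.GaloisRepresentations.DGMBridge (LCarrier)
open Literature.NumberTheory.GaloisRepresentations.IdeleReadout (ideleProjection layerEmb)
open Literature.NumberTheory.Automorphic (IdeleClassGroup.ideleRep)
open Literature.AnabelianGeometry.AbsoluteAnabelian.Prop121vii (zmodToQmodZ brauerInvariantEquiv)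

attribute [local instance] absoluteGaloisGroup_compactSpace

variable (K : Type) [Field K] [NumberField K]

set_option maxHeartbeats 1600000 in
/-- **THE E-SIDE IDÈLE PACKAGE (P0)–(P4) HOLDS** for every number field `K`, every level, every finite `n`-torsion `M`, every
`(f, ŷ, T₀)` (the hypothesis of `poitouTate_selmerStructure_duality_of_idelePackage`, assembled from the tree theorems listed in the
module docstring). [cite: MilneADT2006, Ch. I, Thm. 4.10 (b) (proof, p. 58), Lemma 4.13][cite: CasselsFrohlichANT1967, Ch. VII §11.2 (bis)] -/
theorem idelePackage_holds :
    ∀ (n : ℕ) [NeZero n],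
      ∀ ⦃M : Type⦄ [AddCommGroup M] [TopologicalSpace M] [DiscreteTopology M] [Finite M] [Finite (TateDual K M n)]
      (ρ₀ : DiscreteGaloisModule K M) (hM : ∀ m : M, n • m = 0)
      (ι : ρ₀.toContRepresentation →ⁱL ((ρ₀.tateDual n).tateDual n).toContRepresentation),
      (∀ (m : M) (f : TateDual K M n), ι m f = f m) →
      ∀ (f : (presentationComplex ρ₀).X₁ ⟶ (ideleClassLimitShortComplex K).X₂)
        (ŷ : Abelian.Ext (triv (Γ := absoluteGaloisGroup K) ℤ) (presentationComplex ρ₀).X₃ 1) (T₀ : Finset (Place K)),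
        ∃ (E : GalLayer K) (b : (haveI := E.numberField; cocycles₂ (IdeleClassGroup.ideleRep K E.1)))
          (x : galoisCohomology ρ₀ 1) (Tx : Finset (Place K)), T₀ ⊆ Tx ∧
          (∀ w : InfinitePlace K, (Sum.inl w : Place K) ∈ Tx) ∧
          (∀ v : HeightOneSpectrum (𝓞 K), (Sum.inr v : Place K) ∉ Tx →
            galoisCohomology.localization ρ₀ (Sum.inr v) 1 x ∈ unramifiedSubgroup (GaloisRep.toLocal v ρ₀) 1) ∧
          (haveI := E.numberField; haveI := E.isGalois;
            classBarInv K (ŷ.comp (boundary (presentationComplex_shortExact ρ₀) (classBarD K)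
              (f ≫ (ideleClassLimitShortComplex K).g)) (rfl : 1 + 1 = 2)) =
              IdeleCohomology.inv E.1 (H2π _ b)) ∧
          (∀ v : HeightOneSpectrum (𝓞 K), (Sum.inr v : Place K) ∉ Tx →
            (haveI := E.numberField; haveI := E.isGalois; IdeleCohomology.localInv E.1 v (H2π _ b)) = 0) ∧
          (∀ v : HeightOneSpectrum (𝓞 K),
            (haveI := E.numberField; haveI := E.isGalois; IdeleCohomology.localInv E.1 v (H2π _ b)) =
              haveI := moduleFinite_presModule₁ ρ₀
              haveI : CharZero (v.adicCompletion K) := charZero_of_algebra (K := K) (v.adicCompletion K);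
              brauerInvariantEquiv (v.adicCompletion K)
                (cohomologyMap (toTopRepHom ((presModule₁ ρ₀).restrictField (v.adicCompletion K))
                    (DiscreteGaloisModule.units (v.adicCompletion K))
                    (equivariantMap ((presModule₁ ρ₀).restrictField (v.adicCompletion K))
                      (DiscreteGaloisModule.units (v.adicCompletion K))
                      (readoutInvariant (ideleProjection K (Sum.inr v)) (presentationComplex ρ₀).X₁ f))) 2
                  (galoisCohomology.res (presModule₁ ρ₀) (v.adicCompletion K) 2 ((pres_isSES ρ₀).δ₁ x)))) ∧
          (∀ w : InfinitePlace K, w.IsReal →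
            ((haveI := E.numberField; haveI := E.isGalois;
              twoCocycleClass (DiscreteGaloisModule.units w.Completion).toTopRep
                ((IdeleCohomology.archReadoutPair w (layerEmb E)).pull b)) = 0 ↔
              (haveI := moduleFinite_presModule₁ ρ₀
               cohomologyMap (toTopRepHom ((presModule₁ ρ₀).restrictField w.Completion) (DiscreteGaloisModule.units w.Completion)
                    (equivariantMap ((presModule₁ ρ₀).restrictField w.Completion) (DiscreteGaloisModule.units w.Completion)
                      (readoutInvariant (ideleProjection K (Sum.inl w)) (presentationComplex ρ₀).X₁ f))) 2
                  (galoisCohomology.res (presModule₁ ρ₀) w.Completion 2 ((pres_isSES ρ₀).δ₁ x))) = 0)) := by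
  haveI : TotallyDisconnectedSpace (absoluteGaloisGroup K) := inferInstance
  intro n _ M _ _ _ _ _ ρ₀ hM ι hι f ŷ T₀
  classical
  -- a layer and a layer class inflating to `ŷ`, with a cocycle representative
  obtain ⟨E, hE, c, rfl⟩ := exists_layer_ge_inflG_eq (presentationLayer ρ₀) (presentationComplex ρ₀).X₃ 1 ŷ
  have hsurj : ∀ c' : groupCohomology ((invariantsQuotFunctor ℤ
      (E.openNormalSubgroup : Subgroup (absoluteGaloisGroup K))).obj (presentationComplex ρ₀).X₃) 1,
      ∃ γ : cocycles₁ ((invariantsQuotFunctor ℤ (E.openNormalSubgroup : Subgroup (absoluteGaloisGroup K))).obj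
        (presentationComplex ρ₀).X₃), (H1π _) γ = c' := fun c' =>
    H1_induction_on (C := fun c' => ∃ γ : cocycles₁ ((invariantsQuotFunctor ℤ
      (E.openNormalSubgroup : Subgroup (absoluteGaloisGroup K))).obj (presentationComplex ρ₀).X₃), (H1π _) γ = c') c'
      fun γ => ⟨γ, rfl⟩
  obtain ⟨γ, rfl⟩ := hsurj c
  -- (P1), (P2): the idèle cocycle `b` and the finite support `T`
  obtain ⟨b, T, hb, hP1, hP2⟩ := exists_cocycle_classBarInv_eq_inv ρ₀ hE ((H1π _) γ) f
  -- (P0): the ramification set of the layer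
  obtain ⟨Tur, hTur⟩ := exists_finset_forall_localization_inflatedClass_mem ρ₀ hE
  haveI := E.numberField
  haveI := E.isGalois
  haveI := moduleFinite_presModule₁ ρ₀
  refine ⟨E, b, inflatedClass ρ₀ hE γ,
    T₀ ∪ (Finset.univ.image Sum.inl ∪ (T ∪ Tur).image Sum.inr), Finset.subset_union_left, ?_, ?_, hP1, ?_, ?_, ?_⟩
  · -- every infinite place lies in `Tx`
    intro w
    exact Finset.mem_union_right _ (Finset.mem_union_left _ (Finset.mem_image_of_mem _ (Finset.mem_univ w)))
  · -- (P0)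
    intro v hv
    refine hTur v (fun hvT => hv ?_) γ
    exact Finset.mem_union_right _ (Finset.mem_union_right _ (Finset.mem_image_of_mem _ (Finset.mem_union_right _ hvT)))
  · -- (P2)
    intro v hv
    refine hP2 v fun hvT => hv ?_
    exact Finset.mem_union_right _ (Finset.mem_union_right _ (Finset.mem_image_of_mem _ (Finset.mem_union_left _ hvT)))
  · -- (P3)
    intro v
    exact localInv_H2π_eq_brauerInvariantEquiv ρ₀ hE v γ f b hb
  · -- (P4)
    intro w _
    exact iff_of_eq (congrArg (fun t => t = 0) (twoCocycleClass_archReadoutPair_pull_eq ρ₀ hE w γ f b hb))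


/-- **`poitouTate_selmerStructure_duality K` for EVERY number field `K`** (Milne *ADT* I Cor. 2.3 ∧ Thm. 4.10 (b) ∧ Thm. 2.6 ∧ Howard
Thm. 2.1.11, for one family of local invariant maps at every level — witnessed by THE canonical family), by the E-side idèle package.
[cite: MilneADT2006, Ch. I, Thm. 4.10 (b) (proof, p. 58), Cor. 2.3, Thm. 2.6, Lemma 4.13]
[cite: Howard2004HeegnerKolyvagin, Thm. 2.1.11 (arXiv:1202.6340 p. 6)][cite: CasselsFrohlichANT1967, Ch. VII §11.2 (bis)] -/
theorem poitouTate_selmerStructure_duality_holds : poitouTate_selmerStructure_duality K :=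
  poitouTate_selmerStructure_duality_of_idelePackage (idelePackage_holds K)

end Summit.BirchSwinnertonDyer.BirchSwinnertonDyer.Theorems.SchneiderFreeAdditiveX3.PoitouTateReduction

end
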